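import Mathlib.MeasureTheory.Covering.BesicovitchVectorSpace
import HarnessLib

/-!
# TB-1 brick L-PACK: finitely many disjoint closed balls inside an open set of finite measure cover it up to measure `η`
# (lane T, crux `TextureLiminfV5`, stmt-Ventures-23912; census memo HOME/wulff-p2/g23/TB-COVER-CENSUS-g23.md §B(iv)/§R — multi-radius wall-cell patterns)

HONEST FRAMING. Venture `Summits/Ventures/Crystal3D` (cell `crystal3d-full`), route `route-Ventures-StickyWulffConstant`, helper `--supports` the
law-v5 crux `TextureLiminfV5` (stmt-Ventures-23912).  Pure measure theory on top of Mathlib's measurable Besicovitch covering theorem (census-free, standard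
axioms).  Nothing about any cover, cell or wall is claimed; F-C1 not moved.

WHY (census §B(iii)–(iv)).  A wall cell of `stub_TB_cover` certifies a round DISC of radius `ρ` (the law `BilayerWallAt` is clamped on `p₀² + p₁² ≤ ρ²`)
while the texture pays the prism around it; equal discs in hexagonal prisms lose `13/25·(1 − π/(2√3)) ≈ 0.048` per unit wall area for ever, so the
constructor needs wall-cell patterns of SEVERAL radii whose residual area is `≤ η` — a fixed finite pattern per `η`, scaled by the cell scale.  This file
supplies the pattern abstractly, in any space with the Besicovitch covering property (finite-dimensional real normed spaces, in particular the wall plane):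

* **`exists_finset_disjoint_closedBall_ae_cover`** — for an s-finite measure `μ`, an OPEN set `s` with `μ s < ∞` and `η > 0`, there is a FINITE set of
  centres `x ∈ s` with radii `0 < r x`, closed balls inside `s` and pairwise disjoint, such that `μ (s ∖ ⋃ balls) ≤ η`.
(From `Besicovitch.exists_disjoint_closedBall_covering_ae` — a countable disjoint family covering a.e. — by continuity of the measure along an enumeration.)
-/

noncomputable section

open Metric Set Filter MeasureTheory TopologicalSpace
open scoped Topology ENNReal

namespace Summit.Ventures.Crystal3D.Theorems

variable {α : Type*} [MetricSpace α] [SecondCountableTopology α] [MeasurableSpace α] [OpensMeasurableSpace α]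
  [HasBesicovitchCovering α]

/-- **L-PACK**: finitely many pairwise disjoint closed balls inside an open set of finite measure exhaust it up to measure `η`. -/
theorem exists_finset_disjoint_closedBall_ae_cover (μ : Measure α) [SFinite μ] {s : Set α} (hs : IsOpen s) (hμs : μ s ≠ ∞)
    {η : ℝ≥0∞} (hη : 0 < η) :
    ∃ (F : Finset α) (r : α → ℝ), (∀ x ∈ F, x ∈ s ∧ 0 < r x ∧ closedBall x (r x) ⊆ s) ∧
      (↑F : Set α).PairwiseDisjoint (fun x => closedBall x (r x)) ∧
      μ (s \ ⋃ x ∈ F, closedBall x (r x)) ≤ η := by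
  classical
  -- admissible radii: closed balls inside `s`
  let f : α → Set ℝ := fun x => {ρ | closedBall x ρ ⊆ s}
  have hf : ∀ x ∈ s, ∀ δ > 0, (f x ∩ Ioo 0 δ).Nonempty := by
    intro x hx δ hδ
    obtain ⟨ε, hε, hball⟩ := Metric.isOpen_iff.1 hs x hx
    refine ⟨min (ε / 2) (δ / 2), ?_, ?_, ?_⟩
    · show closedBall x (min (ε / 2) (δ / 2)) ⊆ s
      exact (closedBall_subset_ball (lt_of_le_of_lt (min_le_left _ _) (by linarith))).trans hball
    · exact lt_min (by linarith) (by linarith)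
    · exact lt_of_le_of_lt (min_le_right _ _) (by linarith)
  obtain ⟨t, r, tcount, ts, hr, hnull, hdisj⟩ :=
    Besicovitch.exists_disjoint_closedBall_covering_ae μ f s hf (fun _ => 1) fun _ _ => one_pos
  have hrad : ∀ x ∈ t, 0 < r x ∧ closedBall x (r x) ⊆ s := fun x hx => ⟨(hr x hx).2.1, (hr x hx).1⟩
  -- the empty case
  rcases t.eq_empty_or_nonempty with ht | hne
  · refine ⟨∅, r, by simp, by simp, ?_⟩
    rw [ht] at hnull
    simp only [mem_empty_iff_false, iUnion_of_empty, iUnion_empty, sdiff_empty] at hnull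
    simp only [Finset.notMem_empty, iUnion_of_empty, iUnion_empty, sdiff_empty]
    rw [hnull]; exact zero_le
  -- enumerate the countable family and use continuity of the measure from below
  obtain ⟨g, hg⟩ := tcount.exists_eq_range hne
  let A : ℕ → Set α := fun n => ⋃ k ∈ Finset.range n, closedBall (g k) (r (g k))
  have hAmono : Monotone A := by
    intro m n hmn y hy
    simp only [A, mem_iUnion, Finset.mem_range, exists_prop] at hy ⊢
    obtain ⟨k, hk, hyk⟩ := hy
    exact ⟨k, lt_of_lt_of_le hk hmn, hyk⟩
  have hAU : (⋃ n, A n) = ⋃ x ∈ t, closedBall x (r x) := by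
    ext y
    simp only [A, mem_iUnion, Finset.mem_range, exists_prop]
    constructor
    · rintro ⟨n, k, -, hyk⟩
      exact ⟨g k, by rw [hg]; exact mem_range_self k, hyk⟩
    · rintro ⟨x, hx, hyx⟩
      rw [hg] at hx
      obtain ⟨k, rfl⟩ := hx
      exact ⟨k + 1, k, Nat.lt_succ_self k, hyx⟩
  set U := ⋃ x ∈ t, closedBall x (r x) with hUdef
  have hUs : U ⊆ s := iUnion₂_subset fun x hx => (hrad x hx).2
  have hUfin : μ U ≠ ∞ := ne_top_of_le_ne_top hμs (measure_mono hUs)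
  have htend : Tendsto (fun n => μ (A n)) atTop (𝓝 (μ U)) := by
    rw [← hAU]
    exact tendsto_measure_iUnion_atTop hAmono
  -- choose `n` with `μ U ≤ μ (A n) + η`
  have hev : ∃ n, μ U ≤ μ (A n) + η := by
    by_cases hU0 : μ U = 0
    · exact ⟨0, by rw [hU0]; exact zero_le⟩
    · have hlt : μ U - η < μ U := ENNReal.sub_lt_self hUfin hU0 hη.ne'
      obtain ⟨n, hn⟩ := ((tendsto_order.1 htend).1 _ hlt).exists
      exact ⟨n, tsub_le_iff_right.1 hn.le⟩
  obtain ⟨n, hn⟩ := hev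
  -- the finite family
  refine ⟨(Finset.range n).image g, r, ?_, ?_, ?_⟩
  · intro x hx
    rw [Finset.mem_image] at hx
    obtain ⟨k, -, rfl⟩ := hx
    have hgt : g k ∈ t := by rw [hg]; exact mem_range_self k
    exact ⟨ts hgt, hrad _ hgt⟩
  · intro x hx y hy hxy
    have hx' : x ∈ t := by
      rw [Finset.mem_coe, Finset.mem_image] at hx
      obtain ⟨k, -, rfl⟩ := hx
      rw [hg]; exact mem_range_self k
    have hy' : y ∈ t := by
      rw [Finset.mem_coe, Finset.mem_image] at hy
      obtain ⟨k, -, rfl⟩ := hy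
      rw [hg]; exact mem_range_self k
    exact hdisj hx' hy' hxy
  · have hAeq : (⋃ x ∈ (Finset.range n).image g, closedBall x (r x)) = A n := by
      ext y
      simp only [A, mem_iUnion, Finset.mem_image, Finset.mem_range, exists_prop]
      constructor
      · rintro ⟨x, ⟨k, hk, rfl⟩, hyx⟩
        exact ⟨k, hk, hyx⟩
      · rintro ⟨k, hk, hyk⟩
        exact ⟨g k, ⟨k, hk, rfl⟩, hyk⟩
    rw [hAeq]
    -- `s \ A n ⊆ (s \ U) ∪ (U \ A n)`
    have hsub : s \ A n ⊆ (s \ U) ∪ (U \ A n) := by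
      intro y hy
      by_cases hyU : y ∈ U
      · exact Or.inr ⟨hyU, hy.2⟩
      · exact Or.inl ⟨hy.1, hyU⟩
    have hAnU : A n ⊆ U := by rw [← hAU]; exact subset_iUnion A n
    have hAmeas : MeasurableSet (A n) :=
      MeasurableSet.biUnion (Finset.range n).countable_toSet fun k _ => measurableSet_closedBall
    have hdiff : μ (U \ A n) = μ U - μ (A n) :=
      measure_sdiff hAnU hAmeas.nullMeasurableSet (ne_top_of_le_ne_top hUfin (measure_mono hAnU))
    calc μ (s \ A n) ≤ μ ((s \ U) ∪ (U \ A n)) := measure_mono hsub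
      _ ≤ μ (s \ U) + μ (U \ A n) := measure_union_le _ _
      _ = 0 + (μ U - μ (A n)) := by rw [hnull, hdiff]
      _ ≤ η := by rw [zero_add]; exact tsub_le_iff_left.2 hn

end Summit.Ventures.Crystal3D.Theorems

end
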